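import Mathlib
import Literature.MathematicalPhysics.StatisticalMechanics.BarlowStacking
import Literature.MathematicalPhysics.StatisticalMechanics.HaggStacking

/-!
# Lattice confinement, commensurate case (Gram integrality) for `HcpDiffractionRigidity`
# (item `stmt-AtomisticToContinuum-13166`, stub `stub_latticeConfinementRat`, B2a)

For an hcp template `hcp(a, h)` with `h² = q a²`, `q ∈ ℚ`, every squared template distance lies in
`(a² / (12 · den q)) ℤ` (explicit coordinates `dist_barlowPos_sq` of the Barlow stacking).  Hence
for a set `Λ ∋ 0` all of whose pair distances are template distances, polarisation gives
`⟪p, r⟫ ∈ γ ℤ`, `γ = a² / (24 · den q)`, for `p, r ∈ Λ`.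

The abstract lattice lemma (`exists_lattice_of_basis`): if `B` is a basis of a finite-dimensional
real inner product space with Gram matrix in `γ ℤ^{ι × ι}` (`γ ≠ 0`), then the `ℤ`-span `M` of the
frame `d_j = ∑_i ((G/γ)⁻¹)_{j i} B_i` (dual to `B` up to the factor `γ`) is a full-rank discrete
lattice, contains every `x` with `⟪x, B_i⟫ ∈ γ ℤ` for all `i`, and `|det (G/γ)| · ⟪u, v⟫ ∈ γ ℤ` on
`M` (adjugate formula).  Applied to a basis extracted from `Λ ∪ {√γ · orthonormal basis of
(span Λ)ᗮ}` this gives `stub_latticeConfinementRat`.  All `[folklore]`.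
-/

noncomputable section

namespace Summit.AtomisticToContinuum.Crystallization.Theorems

namespace HcpRigidityConfinement

open Module Submodule
open scoped BigOperators RealInnerProductSpace

section Core

variable {E : Type*} [NormedAddCommGroup E] [InnerProductSpace ℝ E] [FiniteDimensional ℝ E]

/-- **The scaled dual lattice of a `γ`-integral basis.**  If `B` is a basis of `E` with
`⟪B i, B j⟫ = γ G₀ i j`, `G₀` an integer matrix and `γ ≠ 0`, then there is a full-rank discrete
`ℤ`-submodule `M` (the `ℤ`-span of the frame dual to `B` scaled by `γ`) containing every vector
whose inner products with the `B i` lie in `γ ℤ`, on which `D ⟪u, v⟫ ∈ γ ℤ` for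
`D = |det G₀| > 0`. [folklore] -/
theorem exists_lattice_of_basis {ι : Type*} [Fintype ι] (B : Basis ι ℝ E) {γ : ℝ} (hγ : γ ≠ 0)
    (G₀ : Matrix ι ι ℤ) (hG : ∀ i j, ⟪B i, B j⟫ = γ * (G₀ i j : ℝ)) :
    ∃ M : Submodule ℤ E, DiscreteTopology M ∧ span ℝ (M : Set E) = ⊤ ∧
      (∃ D : ℕ, 0 < D ∧ ∀ u ∈ M, ∀ v ∈ M, ∃ n : ℤ, (D : ℝ) * ⟪u, v⟫ = (n : ℝ) * γ) ∧
      ∀ x : E, (∀ i, ∃ m : ℤ, ⟪x, B i⟫ = (m : ℝ) * γ) → x ∈ M := by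
  classical
  -- the real Gram matrix of `B` is `γ • GR`, `GR` the cast of `G₀`
  obtain ⟨GR, hGR⟩ : ∃ GR : Matrix ι ι ℝ, GR = (Int.castRingHom ℝ).mapMatrix G₀ := ⟨_, rfl⟩
  have hGR_apply : ∀ i j, GR i j = (G₀ i j : ℝ) := fun i j => by
    rw [hGR, RingHom.mapMatrix_apply, Matrix.map_apply, eq_intCast]
  have hgram : Matrix.gram ℝ (⇑B) = γ • GR := by
    ext i j
    rw [Matrix.gram_apply, Matrix.smul_apply, smul_eq_mul, hGR_apply, hG]
  have hdetR : GR.det ≠ 0 := by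
    have h := (Matrix.det_gram_ne_zero_iff_linearIndependent (𝕜 := ℝ)).2 B.linearIndependent
    rw [hgram, Matrix.det_smul] at h
    exact right_ne_zero_of_mul h
  have hdetcast : (G₀.det : ℝ) = GR.det := by
    have h := RingHom.map_det (Int.castRingHom ℝ) G₀
    rwa [eq_intCast, ← hGR] at h
  have hdet0 : G₀.det ≠ 0 := by
    intro h0
    apply hdetR
    rw [← hdetcast, h0, Int.cast_zero]
  have hadj : ∀ i j, GR.adjugate i j = (G₀.adjugate i j : ℝ) := by
    intro i j
    have h := RingHom.map_adjugate (Int.castRingHom ℝ) G₀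
    rw [← hGR] at h
    rw [← h, RingHom.mapMatrix_apply, Matrix.map_apply, eq_intCast]
  -- the scaled dual frame `d j = ∑ i A j i • B i`, `A = GR⁻¹`
  obtain ⟨A, hA⟩ : ∃ A : Matrix ι ι ℝ, A = GR.det⁻¹ • GR.adjugate := ⟨_, rfl⟩
  have hAG : A * GR = 1 := by
    rw [hA, Matrix.smul_mul, Matrix.adjugate_mul, smul_smul, inv_mul_cancel₀ hdetR, one_smul]
  obtain ⟨d, hd_def⟩ : ∃ d : ι → E, d = fun j => ∑ i, A j i • B i := ⟨_, rfl⟩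
  have hd : ∀ j l, ⟪d j, B l⟫ = if j = l then γ else 0 := by
    intro j l
    have h1 : (A * GR) j l = if j = l then 1 else 0 := by rw [hAG, Matrix.one_apply]
    rw [Matrix.mul_apply] at h1
    rw [hd_def]
    simp only [sum_inner, real_inner_smul_left, hG]
    calc ∑ i, A j i * (γ * (G₀ i l : ℝ)) = γ * ∑ i, A j i * GR i l := by
          rw [Finset.mul_sum]
          exact Finset.sum_congr rfl fun i _ => by rw [hGR_apply]; ring
      _ = if j = l then γ else 0 := by rw [h1]; split_ifs <;> simp
  -- `d` is linearly independent, hence a basis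
  have hli : LinearIndependent ℝ d := by
    rw [Fintype.linearIndependent_iff]
    intro g hg l
    have h := congrArg (fun z => ⟪z, B l⟫) hg
    simp only [sum_inner, real_inner_smul_left, hd, mul_ite, mul_zero, Finset.sum_ite_eq',
      Finset.mem_univ, if_true, inner_zero_left] at h
    exact (mul_eq_zero.1 h).resolve_right hγ
  have hcard : Fintype.card ι = finrank ℝ E := (finrank_eq_card_basis B).symm
  obtain ⟨dB, hdB⟩ : ∃ dB : Basis ι ℝ E, ⇑dB = d :=
    ⟨basisOfLinearIndependentOfCardEqFinrank' d hli hcard,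
      coe_basisOfLinearIndependentOfCardEqFinrank' d hli hcard⟩
  refine ⟨span ℤ (Set.range ⇑dB), inferInstance, ZSpan.span_top dB, ?_, ?_⟩
  · -- Gram rationality on `M`
    have hdd : ∀ j l, (G₀.det : ℝ) * ⟪d j, d l⟫ = γ * (G₀.adjugate l j : ℝ) := by
      intro j l
      have h1 : ⟪d j, d l⟫ = γ * A l j := by
        have h2 : d l = ∑ i, A l i • B i := by rw [hd_def]
        rw [h2, inner_sum]
        simp only [real_inner_smul_right, hd, mul_ite, mul_zero, Finset.sum_ite_eq,
          Finset.mem_univ, if_true]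
        ring
      rw [h1, hA, Matrix.smul_apply, smul_eq_mul, hadj, hdetcast]
      field_simp
    have key : ∀ u ∈ span ℤ (Set.range ⇑dB), ∀ v ∈ span ℤ (Set.range ⇑dB),
        ∃ n : ℤ, (G₀.det : ℝ) * ⟪u, v⟫ = (n : ℝ) * γ := by
      intro u hu
      induction hu using Submodule.span_induction with
      | mem u hu =>
        obtain ⟨j, rfl⟩ := hu
        intro v hv
        induction hv using Submodule.span_induction with
        | mem v hv =>
          obtain ⟨l, rfl⟩ := hv
          exact ⟨G₀.adjugate l j, by rw [hdB, hdd]; ring⟩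
        | zero => exact ⟨0, by simp⟩
        | add x y _ _ hx hy =>
          obtain ⟨m, hm⟩ := hx
          obtain ⟨n, hn⟩ := hy
          exact ⟨m + n, by rw [inner_add_right, mul_add, hm, hn]; push_cast; ring⟩
        | smul k x _ hx =>
          obtain ⟨m, hm⟩ := hx
          refine ⟨k * m, ?_⟩
          rw [← Int.cast_smul_eq_zsmul ℝ k x, real_inner_smul_right, mul_left_comm, hm]
          push_cast
          ring
      | zero => exact fun v _ => ⟨0, by simp⟩
      | add x y _ _ hx hy =>
        intro v hv
        obtain ⟨m, hm⟩ := hx v hv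
        obtain ⟨n, hn⟩ := hy v hv
        exact ⟨m + n, by rw [inner_add_left, mul_add, hm, hn]; push_cast; ring⟩
      | smul k x _ hx =>
        intro v hv
        obtain ⟨m, hm⟩ := hx v hv
        refine ⟨k * m, ?_⟩
        rw [← Int.cast_smul_eq_zsmul ℝ k x, real_inner_smul_left, mul_left_comm, hm]
        push_cast
        ring
    refine ⟨G₀.det.natAbs, Int.natAbs_pos.2 hdet0, fun u hu v hv => ?_⟩
    obtain ⟨n, hn⟩ := key u hu v hv
    rcases abs_choice (G₀.det : ℝ) with habs | habs
    · exact ⟨n, by rw [Nat.cast_natAbs, Int.cast_abs, habs, hn]⟩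
    · exact ⟨-n, by rw [Nat.cast_natAbs, Int.cast_abs, habs, neg_mul, hn]; push_cast; ring⟩
  · -- every `γ`-integral vector lies in `M`
    intro x hx
    choose m hm using hx
    have hxe : x = ∑ j, (m j : ℝ) • dB j := by
      refine InnerProductSpace.ext_inner_right_basis B fun l => ?_
      rw [hdB]
      simp only [sum_inner, real_inner_smul_left, hd, mul_ite, mul_zero, Finset.sum_ite_eq',
        Finset.mem_univ, if_true]
      exact hm l
    rw [hxe]
    refine Submodule.sum_mem _ fun j _ => ?_
    rw [Int.cast_smul_eq_zsmul ℝ (m j)]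
    exact Submodule.smul_mem _ _ (Submodule.subset_span (Set.mem_range_self j))

/-- **Gram integrality, spanning case.**  If all inner products of a spanning set `Λ` lie in
`γ ℤ` (`γ ≠ 0`), then `Λ` lies in a full-rank discrete lattice `M` with `D ⟪u, v⟫ ∈ γ ℤ` on `M`
for one `D > 0` (apply `exists_lattice_of_basis` to a basis extracted from `Λ`). [folklore] -/
theorem exists_lattice_of_inner_of_span_eq_top {Λ : Set E} {γ : ℝ} (hγ : γ ≠ 0)
    (hΛ : ∀ p ∈ Λ, ∀ r ∈ Λ, ∃ m : ℤ, ⟪p, r⟫ = (m : ℝ) * γ) (hsp : span ℝ Λ = ⊤) :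
    ∃ M : Submodule ℤ E, DiscreteTopology M ∧ span ℝ (M : Set E) = ⊤ ∧
      (∃ D : ℕ, 0 < D ∧ ∀ u ∈ M, ∀ v ∈ M, ∃ n : ℤ, (D : ℝ) * ⟪u, v⟫ = (n : ℝ) * γ) ∧ Λ ⊆ M := by
  classical
  obtain ⟨b, hbΛ, hbsp, hbli⟩ := exists_linearIndependent ℝ Λ
  have hbtop : ⊤ ≤ span ℝ (Set.range ((↑) : b → E)) := by
    rw [Subtype.range_coe, hbsp, hsp]
  set B : Basis b ℝ E := Basis.mk hbli hbtop with hB_def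
  have hB : ∀ i, B i = (i : E) := fun i => by rw [hB_def, Basis.mk_apply]
  haveI : Finite b := Module.Finite.finite_basis B
  letI : Fintype b := Fintype.ofFinite b
  have hBB : ∀ i j : b, ∃ m : ℤ, ⟪B i, B j⟫ = (m : ℝ) * γ := fun i j => by
    rw [hB, hB]; exact hΛ _ (hbΛ i.2) _ (hbΛ j.2)
  choose G₀ hG₀ using hBB
  obtain ⟨M, hMd, hMsp, hMD, hMmem⟩ := exists_lattice_of_basis B hγ (Matrix.of G₀)
    (fun i j => by rw [Matrix.of_apply, hG₀, mul_comm])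
  refine ⟨M, hMd, hMsp, hMD, fun x hx => hMmem x fun i => ?_⟩
  rw [hB]
  exact hΛ x hx _ (hbΛ i.2)

/-- **Gram integrality.**  If all inner products of a set `Λ` lie in `γ ℤ` (`γ > 0`), then `Λ`
lies in a full-rank discrete lattice `M` with `D ⟪u, v⟫ ∈ γ ℤ` on `M` for one `D > 0`: enlarge
`Λ` by `√γ` times an orthonormal basis of `(span Λ)ᗮ` and apply the spanning case. [folklore] -/
theorem exists_lattice_of_inner {Λ : Set E} {γ : ℝ} (hγ : 0 < γ)
    (hΛ : ∀ p ∈ Λ, ∀ r ∈ Λ, ∃ m : ℤ, ⟪p, r⟫ = (m : ℝ) * γ) :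
    ∃ M : Submodule ℤ E, DiscreteTopology M ∧ span ℝ (M : Set E) = ⊤ ∧
      (∃ D : ℕ, 0 < D ∧ ∀ u ∈ M, ∀ v ∈ M, ∃ n : ℤ, (D : ℝ) * ⟪u, v⟫ = (n : ℝ) * γ) ∧ Λ ⊆ M := by
  classical
  set V : Submodule ℝ E := span ℝ Λ
  set ob := stdOrthonormalBasis ℝ Vᗮ
  obtain ⟨e, he⟩ : ∃ e : Fin (finrank ℝ Vᗮ) → E, e = fun i => √γ • (ob i : E) := ⟨_, rfl⟩
  have hsq : √γ * √γ = γ := Real.mul_self_sqrt hγ.le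
  have hsq0 : √γ ≠ 0 := (Real.sqrt_pos.2 hγ).ne'
  have h1 : ∀ p ∈ Λ, ∀ i, ⟪p, e i⟫ = 0 := by
    intro p hp i
    rw [he, real_inner_smul_right,
      Submodule.inner_right_of_mem_orthogonal (Submodule.subset_span hp) (ob i).2, mul_zero]
  have h2 : ∀ i j, ⟪e i, e j⟫ = if i = j then γ else 0 := by
    intro i j
    rw [he]
    simp only [real_inner_smul_left, real_inner_smul_right, ← Submodule.coe_inner]
    rw [orthonormal_iff_ite.1 ob.orthonormal i j]
    split_ifs
    · rw [mul_one, hsq]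
    · rw [mul_zero, mul_zero]
  have hΛ' : ∀ p ∈ Λ ∪ Set.range e, ∀ r ∈ Λ ∪ Set.range e, ∃ m : ℤ, ⟪p, r⟫ = (m : ℝ) * γ := by
    rintro p (hp | ⟨i, rfl⟩) r (hr | ⟨j, rfl⟩)
    · exact hΛ p hp r hr
    · exact ⟨0, by rw [h1 p hp j]; simp⟩
    · exact ⟨0, by rw [real_inner_comm, h1 r hr i]; simp⟩
    · by_cases hij : i = j
      · exact ⟨1, by rw [h2, if_pos hij]; simp⟩
      · exact ⟨0, by rw [h2, if_neg hij]; simp⟩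
  have hVo : Vᗮ ≤ span ℝ (Set.range e) := by
    intro y hy
    have h3 : ∑ i, (ob.repr ⟨y, hy⟩ i * (√γ)⁻¹) • e i = y := by
      have h4 := congrArg (fun z : Vᗮ => (z : E)) (ob.sum_repr ⟨y, hy⟩)
      simp only [Submodule.coe_sum, Submodule.coe_smul] at h4
      refine Eq.trans (Finset.sum_congr rfl fun i _ => ?_) h4
      rw [he, smul_smul, mul_assoc, inv_mul_cancel₀ hsq0, mul_one]
    rw [← h3]
    exact Submodule.sum_mem _ fun i _ =>
      Submodule.smul_mem _ _ (Submodule.subset_span (Set.mem_range_self i))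
  have hsp : span ℝ (Λ ∪ Set.range e) = ⊤ := by
    rw [Submodule.span_union, eq_top_iff, ← Submodule.sup_orthogonal_of_hasOrthogonalProjection
      (K := V)]
    exact sup_le_sup_left hVo V
  obtain ⟨M, hMd, hMsp, hMD, hsub⟩ := exists_lattice_of_inner_of_span_eq_top hγ.ne' hΛ' hsp
  exact ⟨M, hMd, hMsp, hMD, fun x hx => hsub (Set.mem_union_left _ hx)⟩

end Core

/-! ## The hcp template: squared distances and inner products -/

open Literature.MathematicalPhysics.StatisticalMechanics

/-- **Squared distances of a Barlow stacking with `h² = q a²` are `a² / (12 · den q)`-integral**: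
`12 · den q · dist² ∈ a² ℤ` (from the coordinate formula `dist_barlowPos_sq`). [folklore] -/
theorem barlow_dist_sq {a h : ℝ} {s : ℤ → ℤ} {q : ℚ} (hq : h ^ 2 = (q : ℝ) * a ^ 2)
    {x y : EuclideanSpace ℝ (Fin 3)} (hx : x ∈ barlowStacking a h s)
    (hy : y ∈ barlowStacking a h s) :
    ∃ m : ℤ, (12 * q.den : ℝ) * dist x y ^ 2 = (m : ℝ) * a ^ 2 := by
  obtain ⟨k, i, j, rfl⟩ := mem_barlowStacking_iff.1 hx
  obtain ⟨k', i', j', rfl⟩ := mem_barlowStacking_iff.1 hy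
  rw [dist_barlowPos_sq]
  generalize haggLabel s k = L
  generalize haggLabel s k' = L'
  have h3 : (√3 : ℝ) ^ 2 = 3 := Real.sq_sqrt (by norm_num)
  have hqn : (q : ℝ) * (q.den : ℝ) = (q.num : ℝ) := by exact_mod_cast Rat.mul_den_eq_num q
  refine ⟨3 * q.den * (2 * (i - i') + (j - j') + (L - L')) ^ 2 +
    q.den * (3 * (j - j') + (L - L')) ^ 2 + 12 * (k - k') ^ 2 * q.num, ?_⟩
  push_cast
  linear_combination (3 * (q.den : ℝ) * a ^ 2 * (((j : ℝ) - j') + ((L : ℝ) - L') / 3) ^ 2) * h3 +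
    (12 * ((k : ℝ) - k') ^ 2 * (q.den : ℝ)) * hq + (12 * ((k : ℝ) - k') ^ 2 * a ^ 2) * hqn

/-- **Inner products of a template-exact set are `a² / (24 · den q)`-integral.**  If `0 ∈ Λ` and
all pair distances of `Λ` are distances of the hcp template with `h² = q a²`, then
`⟪p, r⟫ ∈ (a² / (24 · den q)) ℤ` for `p, r ∈ Λ` (polarisation). [folklore] -/
theorem hcp_inner {a h : ℝ} (ha : a ≠ 0) (hh : h ≠ 0) {q : ℚ} (hq : h ^ 2 = (q : ℝ) * a ^ 2)
    {Λ : Set (EuclideanSpace ℝ (Fin 3))} (h0 : (0 : EuclideanSpace ℝ (Fin 3)) ∈ Λ)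
    (hΛ : ∀ p ∈ Λ, ∀ q ∈ Λ, ∃ a' ∈ (hcpPeriodicConfiguration ha hh).points,
      ∃ b' ∈ (hcpPeriodicConfiguration ha hh).points, dist p q = dist a' b')
    {p r : EuclideanSpace ℝ (Fin 3)} (hp : p ∈ Λ) (hr : r ∈ Λ) :
    ∃ m : ℤ, ⟪p, r⟫ = (m : ℝ) * (a ^ 2 / (24 * q.den)) := by
  have hD : ∀ p ∈ Λ, ∀ r ∈ Λ, ∃ m : ℤ, (12 * q.den : ℝ) * dist p r ^ 2 = (m : ℝ) * a ^ 2 := by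
    intro p hp r hr
    obtain ⟨a', ha', b', hb', hpr⟩ := hΛ p hp r hr
    rw [hcpPeriodicConfiguration_points] at ha' hb'
    rw [hpr]
    exact barlow_dist_sq hq ha' hb'
  obtain ⟨m₁, hm₁⟩ := hD p hp 0 h0
  obtain ⟨m₂, hm₂⟩ := hD r hr 0 h0
  obtain ⟨m₃, hm₃⟩ := hD p hp r hr
  rw [dist_zero_right] at hm₁ hm₂
  rw [dist_eq_norm] at hm₃
  have key : (24 * q.den : ℝ) * ⟪p, r⟫ = ((m₁ + m₂ - m₃ : ℤ) : ℝ) * a ^ 2 := by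
    rw [real_inner_eq_norm_mul_self_add_norm_mul_self_sub_norm_sub_mul_self_div_two]
    push_cast
    linear_combination hm₁ + hm₂ - hm₃
  have hqd : (0 : ℝ) < q.den := by positivity
  refine ⟨m₁ + m₂ - m₃, ?_⟩
  field_simp
  linear_combination key

end HcpRigidityConfinement

open Literature.MathematicalPhysics.StatisticalMechanics
open scoped RealInnerProductSpace

/-- **STUB B2a — lattice confinement, commensurate case (Gram integrality).** For an hcp
template with `h² = q a²`, `q ∈ ℚ`, every squared template distance lies in `(a²/(12·den q)) ℤ`
(`dist_barlowPos_sq`); hence for a set `Λ ∋ 0` all of whose pair distances are template distances,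
`2⟪p, r⟫ = ‖p‖² + ‖r‖² − ‖p − r‖² ∈ (a²/(12 den q)) ℤ` for `p, r ∈ Λ`, and `Λ` lies in the
full-rank lattice `M` dual (up to that factor) to a basis extracted from `Λ` (completed by
orthogonal vectors of squared norm `a²/(24 den q)` if `Λ` does not span), whose Gram matrix is
`a²`-rational with one denominator `D`. [folklore] -/
theorem stub_latticeConfinementRat : ∀ (a h : ℝ) (ha : a ≠ 0) (hh : h ≠ 0), (∃ q : ℚ, h ^ 2 = (q : ℝ) * a ^ 2) → ∀ Λ : Set (EuclideanSpace ℝ (Fin 3)), (0 : EuclideanSpace ℝ (Fin 3)) ∈ Λ → (∀ p ∈ Λ, ∀ q ∈ Λ, ∃ a' ∈ (Literature.MathematicalPhysics.StatisticalMechanics.hcpPeriodicConfiguration ha hh).points, ∃ b' ∈ (Literature.MathematicalPhysics.StatisticalMechanics.hcpPeriodicConfiguration ha hh).points, dist p q = dist a' b') → ∃ M : Submodule ℤ (EuclideanSpace ℝ (Fin 3)), DiscreteTopology M ∧ Submodule.span ℝ (M : Set (EuclideanSpace ℝ (Fin 3))) = ⊤ ∧ (∃ D : ℕ, 0 < D ∧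 ∀ u ∈ M, ∀ v ∈ M, ∃ n : ℤ, (D : ℝ) * inner ℝ u v = (n : ℝ) * a ^ 2) ∧ Λ ⊆ M := by
  intro a h ha hh hq Λ h0 hΛ
  obtain ⟨q, hq⟩ := hq
  have hγ : (0 : ℝ) < a ^ 2 / (24 * q.den) := by positivity
  have hinner : ∀ p ∈ Λ, ∀ r ∈ Λ, ∃ m : ℤ, ⟪p, r⟫ = (m : ℝ) * (a ^ 2 / (24 * q.den)) :=
    fun p hp r hr => HcpRigidityConfinement.hcp_inner ha hh hq h0 hΛ hp hr
  obtain ⟨M, hMd, hMsp, ⟨D, hD, hMD⟩, hsub⟩ :=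
    HcpRigidityConfinement.exists_lattice_of_inner hγ hinner
  refine ⟨M, hMd, hMsp, ⟨D * (24 * q.den), Nat.mul_pos hD (by positivity), fun u hu v hv => ?_⟩,
    hsub⟩
  obtain ⟨n, hn⟩ := hMD u hu v hv
  refine ⟨n, ?_⟩
  have hqd : (0 : ℝ) < q.den := by positivity
  have ha2 : (24 * q.den : ℝ) * (a ^ 2 / (24 * q.den)) = a ^ 2 := by field_simp
  push_cast
  linear_combination (24 * (q.den : ℝ)) * hn + (n : ℝ) * ha2

end Summit.AtomisticToContinuum.Crystallization.Theorems
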